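import Summits.CriticalPhenomena.CardyFormulaZ2.Theses.CardySelfDualSegment
import Summits.CriticalPhenomena.CardyFormulaZ2.Theorems.CardyMagicRigidityLoopsToCrossingsStubComparisonGeometry
import Summits.CriticalPhenomena.CardyFormulaZ2.Theorems.CardyMagicRigidityLoopsToCrossingsStubCardyContinuity
import Literature.Probability.Percolation.CornerPercolation
import Literature.Probability.Percolation.CardyFormulaConformalInvariance
import Literature.Probability.Percolation.TriCrossingSandwich
import Literature.Probability.LatticeModels.TriangularLatticeProofs
import Literature.Probability.RandomPlanarGeometry.ImageUnivalent
import Literature.Probability.RandomPlanarGeometry.CollarGeometry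
import Literature.Barriers.CriticalPhenomena.EmbeddingModulusUniquenessProofs

import Summits.CriticalPhenomena.CardyFormulaZ2.Theorems.CardySelfDualSegmentSmirnovBasePointShearDictionary
import Summits.CriticalPhenomena.CardyFormulaZ2.Theorems.CardySelfDualSegmentSmirnovBasePointBondRealisation
import Summits.CriticalPhenomena.CardyFormulaZ2.Theorems.CardySelfDualSegmentSmirnovBasePointLowerInclusion
import Summits.CriticalPhenomena.CardyFormulaZ2.Theorems.CardySelfDualSegmentSmirnovBasePointUpperQuad
import Summits.CriticalPhenomena.CardyFormulaZ2.Theorems.CardySelfDualSegmentSmirnovBasePointOwnerExtraction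
import Summits.CriticalPhenomena.CardyFormulaZ2.Theorems.CardySelfDualSegmentSmirnovBasePointUpperInclusion
import Summits.CriticalPhenomena.CardyFormulaZ2.Theorems.CardySelfDualSegmentSmirnovBasePointSqueeze

/-!
# `SmirnovBasePoint` (item stmt-CriticalPhenomena-5474): Cardy's formula for the crude `M_0` event, sheared

Route `CardySelfDualSegment`, sub-problem `CardyFormulaZ2`, crux `SmirnovBasePoint` = `CardyMod 0 triZeta`:
for conformal rectangles `R`, `R'` with `R = φ_ζ R'` (carrier and marked points; `φ_ζ = moduliShear triZeta`,
Beffara's shear `x + iy ↦ x + ζ y`, `ζ = e^{iπ/3}`) and every uniformizing datum `(φ, x)` of `R`, the crude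
`M_0` crossing probability `P 0 R' δ = cornerCrossingProb 0 R' δ` of `R'` (corner percolation at `t = 0` = site
percolation on `𝕋` pushed to bonds by `upTriangleConfig`, `cornerPercolation_zero`; drawn on `√2ℤ²`, event
`embDomainCrossing`: open path with all vertices in `Ω'`, endpoints within `2δ` of the arcs `0`, `2`) tends to
Cardy's value `F(crossRatio x)` as `δ → 0⁺`.

Proof (line `Sketch` = sheared two-quad oracle sandwich, Bollobás–Riordan 2006 Ch. 7 Lemma 14 / remark
p. 195 for the crude event). Work in the triangular frame `S = R'.map φ_ζ`: the square mesh `δ` is the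
`𝕋`-mesh `√2 δ` and the crude event sits between the two `𝕋`-frame crude events of `S` with slacks `δ'` and
`2δ'` (`stub_shearDictionary`: law `cornerPercolation_zero`, mesh `φ_ζ (δ z(v)) = triMeshPoint (√2 δ) v`,
distances `|w|/√2 ≤ |φ_ζ w| ≤ √(3/2)|w|`). The `𝕋`-frame crude event of `S` is squeezed between G02
`triCrossing` events of the LOWER comparison quad `Q` of `S` (`OracleSandwich.exists_lowerQuad`; exact
deterministic inclusion `stub_lowerInclusion`, via the bond realisation of open-owner paths
`stub_bondRealisation` and run extraction) and of the UPPER comparison quad `N` of `S` (`stub_upperQuad`: tube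
profile low along the arcs `0, 2` through the corners, high across the arcs `1, 3`; exact inclusion
`stub_upperInclusion`, via owner extraction `stub_ownerExtraction`, boundary-contact trimming and
`mem_triCrossing_of_pathIn N` with plate margin `δ'`). Smirnov's theorem
(`hasCrossingLimit_triDomainCrossingProb_holds`) on `Q`, `N` and `OracleSandwich.stub_cardyContinuity` (Radó)
give the limit (`stub_squeeze`). Finally the uniformizing datum of `R` is one of `S` (same carrier and marked
points: `ConformalRectangle.HasCrossingLimit.of_image_data` with `h = id`), so the arcs of `R` are never used.

## References

* B. Bollobás, O. Riordan, *Percolation*, Cambridge University Press (2006), Ch. 7, Lemma 14 p. 184, Claim 19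
  p. 192, remark p. 195.
* S. Smirnov, *Critical percolation in the plane*, C. R. Acad. Sci. Paris 333 (2001), Thm. 1, §2.
* V. Beffara, *Is critical 2D percolation universal?*, Progr. Probab. 60 (2008), §1.1 (the shear `φ_β`).
-/

noncomputable section

namespace Summit.CriticalPhenomena.CardyFormulaZ2.Cruxes.SmirnovBasePoint.ShearedSandwich

open Literature.Probability.RandomPlanarGeometry hiding cardyFunction
open Literature.Probability.Percolation hiding cardyFunction
open Literature.Probability.LatticeModels
open Literature.Barriers.CriticalPhenomena
open Summit.CriticalPhenomena.CardyFormulaZ2.Cruxes.LoopsToCrossings.OracleSandwich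
open Filter Topology Set MeasureTheory Metric

/-! ## Composition -/

/-- `√2 · (δ / √2) = δ`. [folklore] -/
theorem sqrt_two_mul_div_sqrt_two (δ : ℝ) : Real.sqrt 2 * (δ / Real.sqrt 2) = δ :=
  mul_div_cancel₀ δ (Real.sqrt_ne_zero'.2 two_pos)

/-- `(√2 · δ) / √2 = δ`. [folklore] -/
theorem sqrt_two_mul_div_sqrt_two' (δ : ℝ) : Real.sqrt 2 * δ / Real.sqrt 2 = δ :=
  mul_div_cancel_left₀ δ (Real.sqrt_ne_zero'.2 two_pos)

/-- **The dictionary in the triangular frame.** For `S = R'.map φ_ζ` and `𝕋`-mesh `δ`, the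
square-frame crude probability `cornerCrossingProb 0 R' (δ/√2)` sits between the `𝕋`-frame crude
probabilities of `S` with slacks `δ` and `2δ`. [cite: Beffara2008Universal, §1.1] -/
theorem dictionary (R' : ConformalRectangle) {δ : ℝ} (hδ : 0 < δ) :
    (triSitePercolation half).real (upTriangleConfig ⁻¹' openCrossing
        {y : Site 2 | triMeshPoint δ y ∈ (R'.map (shearHomeomorph triZeta Literature.Probability.Percolation.triZeta_im_ne_zero)).carrier}
        {u : Site 2 | infDist (triMeshPoint δ u) ((R'.map (shearHomeomorph triZeta Literature.Probability.Percolation.triZeta_im_ne_zero)).arc 0) ≤ δ}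
        {v : Site 2 | infDist (triMeshPoint δ v) ((R'.map (shearHomeomorph triZeta Literature.Probability.Percolation.triZeta_im_ne_zero)).arc 2) ≤ δ})
      ≤ cornerCrossingProb 0 R' (δ / Real.sqrt 2) ∧
    cornerCrossingProb 0 R' (δ / Real.sqrt 2) ≤ (triSitePercolation half).real (upTriangleConfig ⁻¹' openCrossing
        {y : Site 2 | triMeshPoint δ y ∈ (R'.map (shearHomeomorph triZeta Literature.Probability.Percolation.triZeta_im_ne_zero)).carrier}
        {u : Site 2 | infDist (triMeshPoint δ u) ((R'.map (shearHomeomorph triZeta Literature.Probability.Percolation.triZeta_im_ne_zero)).arc 0) ≤ 2 * δ}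
        {v : Site 2 | infDist (triMeshPoint δ v) ((R'.map (shearHomeomorph triZeta Literature.Probability.Percolation.triZeta_im_ne_zero)).arc 2) ≤ 2 * δ}) := by
  have h := stub_shearDictionary R' (δ / Real.sqrt 2) (div_pos hδ (Real.sqrt_pos.2 two_pos))
  rw [sqrt_two_mul_div_sqrt_two] at h
  simpa only [MarkedDomain.carrier_map, MarkedDomain.arc_map, coe_shearHomeomorph] using h

/-- **Cardy's formula for the crude `M_0` event in the triangular frame**: for every conformal
rectangle `R'`, the rectangle `S = φ_ζ R'` has crossing limit `F` for the family
`δ ↦ cornerCrossingProb 0 R' (δ/√2)`. [cite: BollobasRiordan2006, Ch. 7 Lemma 14 p. 184 and remark p. 195] -/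
theorem hasCrossingLimit_shear (R' : ConformalRectangle) :
    ConformalRectangle.HasCrossingLimit (R'.map (shearHomeomorph triZeta Literature.Probability.Percolation.triZeta_im_ne_zero))
      (fun δ => cornerCrossingProb 0 R' (δ / Real.sqrt 2))
      Literature.Probability.RandomPlanarGeometry.cardyFunction := by
  set S : ConformalRectangle := R'.map (shearHomeomorph triZeta Literature.Probability.Percolation.triZeta_im_ne_zero)
  refine stub_squeeze stub_upperQuad S _ ?_ ?_
  · -- lower: `tri Q δ ≤ crude_𝕋(S, δ, slack δ) ≤ corner (δ/√2)`
    intro Q r m t hr hm ht hsep c1 c2 c3 c4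
    obtain ⟨δ₀, hδ₀, hincl⟩ :=
      stub_lowerInclusion stub_bondRealisation S Q r m t hr hm ht hsep c1 c2 c3 c4
    refine ⟨δ₀, hδ₀, fun δ hδ hδδ₀ => ?_⟩
    rw [triDomainCrossingProb_eq_measureReal]
    exact (measureReal_mono (hincl δ hδ hδδ₀) (measure_ne_top _ _)).trans (dictionary R' hδ).1
  · -- upper: `corner (δ/√2) ≤ crude_𝕋(S, δ, slack 2δ) ≤ tri N δ`
    intro N r m τ hr hm hτ hsep hb hc hd hf0 hf2
    obtain ⟨δ₀, hδ₀, hincl⟩ :=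
      stub_upperInclusion stub_ownerExtraction S N r m τ hr hm hτ hsep hb hc hd hf0 hf2
    refine ⟨δ₀, hδ₀, fun δ hδ hδδ₀ => ?_⟩
    rw [triDomainCrossingProb_eq_measureReal]
    exact (dictionary R' hδ).2.trans (measureReal_mono (hincl δ hδ hδδ₀) (measure_ne_top _ _))

/-- `δ ↦ √2 δ` maps `δ → 0⁺` to `δ → 0⁺`. [folklore] -/
theorem tendsto_sqrt_two_mul :
    Tendsto (fun δ : ℝ => Real.sqrt 2 * δ) (𝓝[>] 0) (𝓝[>] 0) := by
  refine tendsto_nhdsWithin_iff.2 ⟨?_, ?_⟩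
  · have h : Tendsto (fun δ : ℝ => Real.sqrt 2 * δ) (𝓝 0) (𝓝 (Real.sqrt 2 * 0)) :=
      tendsto_id.const_mul _
    rw [mul_zero] at h
    exact h.mono_left nhdsWithin_le_nhds
  · filter_upwards [self_mem_nhdsWithin] with δ hδ
    exact mul_pos (Real.sqrt_pos.2 two_pos) hδ

/-- **The crux in Literature vocabulary**: for conformal rectangles `R`, `R'` with
`R = φ_ζ R'` (carrier and marked points) and a uniformizing datum `(φ, x)` of `R`,
`cornerCrossingProb 0 R' δ → F(crossRatio x)` as `δ → 0⁺`. [cite: Smirnov2001, Thm. 1] -/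
theorem tendsto_cornerCrossingProb_zero (R R' : ConformalRectangle)
    (φ : ConformalEquiv UpperHalfPlane.upperHalfPlaneSet R.carrier) (x : Fin 4 → ℝ)
    (hcar : R.carrier = moduliShear triZeta '' R'.carrier)
    (hpt : ∀ i, R.pt i = moduliShear triZeta (R'.pt i)) (hφ : R.IsUniformizing φ x) :
    Tendsto (cornerCrossingProb 0 R') (𝓝[>] 0)
      (𝓝 (Literature.Probability.RandomPlanarGeometry.cardyFunction (crossRatio x))) := by
  set S : ConformalRectangle := R'.map (shearHomeomorph triZeta Literature.Probability.Percolation.triZeta_im_ne_zero)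
  -- the uniformizing datum of `R` is one of `S` (same carrier, same marked points)
  have hSc : S.carrier = id '' R.carrier := by
    rw [Set.image_id, hcar]; rfl
  have hSp : ∀ i, S.pt i = id (R.pt i) := fun i => by
    rw [id, hpt i]; rfl
  have hlim : R.HasCrossingLimit (fun δ => cornerCrossingProb 0 R' (δ / Real.sqrt 2))
      Literature.Probability.RandomPlanarGeometry.cardyFunction :=
    ConformalRectangle.HasCrossingLimit.of_image_data differentiableOn_id (injOn_id _)
      continuousOn_id hSc hSp (hasCrossingLimit_shear R')
  have h := (hlim φ x hφ).comp tendsto_sqrt_two_mul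
  refine h.congr fun δ => ?_
  simp only [Function.comp_apply, sqrt_two_mul_div_sqrt_two']

end Summit.CriticalPhenomena.CardyFormulaZ2.Cruxes.SmirnovBasePoint.ShearedSandwich

namespace Summit.CriticalPhenomena.CardyFormulaZ2.Theorems

open Summit.CriticalPhenomena.CardyFormulaZ2.Cruxes.SmirnovBasePoint.ShearedSandwich

/-- **`SmirnovBasePoint` (item stmt-CriticalPhenomena-5474)**: `CardyMod 0 triZeta` — for `R = φ_ζ R'`
(carrier and marked points) and every uniformizing datum `(φ, x)` of `R`, the crude `M_0` crossing
probability `P 0 R' δ` of `R'` tends to `F(crossRatio x)` as `δ → 0⁺`. The route's inlined `P 0 R' δ` is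
literally `cornerCrossingProb 0 R' δ` (`CornerPercolation.lean`), and the claim is
`tendsto_cornerCrossingProb_zero`. [cite: BollobasRiordan2006, Ch. 7 Lemma 14 p. 184 and remark p. 195]
[cite: Smirnov2001, Thm. 1] -/
theorem smirnovBasePoint_proof :
    Summit.CriticalPhenomena.CardyFormulaZ2.Theses.CardySelfDualSegment.SmirnovBasePoint := by
  intro R R' φ x hcar hpt hφ
  exact tendsto_cornerCrossingProb_zero R R' φ x hcar hpt hφ

end Summit.CriticalPhenomena.CardyFormulaZ2.Theorems
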